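import Summits.Ventures.HodgeKum4.Theorems.KummerFixedLocusHilbertKummerTransferDirections
import Summits.Ventures.HodgeKum4.Theses.KummerFixedLocus
import Literature.AlgebraicGeometry.Hyperkaehler.IrreducibleSymplecticOfDeformationType
import Literature.AlgebraicTopology.SingularHomology.KroneckerDegreeOne
import Literature.AlgebraicGeometry.Motives.AbelianVarietyProjectiveChart
import HarnessLib

/-!
# V0 = `HilbertKummerTransfer` PROVED modulo its two refereed print antecedents (cell `hodge-kum4`, lane (V), seat p2)

Route `KummerFixedLocus`, crux item `HilbertKummerTransfer` (stmt-Ventures-20354, rank 3), whose route decl is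
(plan g18 (C-b′), director-hodge 2026-08-27T10:18:51Z)

  `Summit.Ventures.HodgeKum4.Theses.KummerFixedLocus.HilbertKummerTransfer :=
     Hyperkaehler.Beauville1983_irreducibleSymplectic_of_kummerType →
     HilbertScheme.Beauville1983_kummerCover_galois → Summit.Ventures.HodgeKum4.HilbertKummerTransfer`.

**`hilbertKummerTransfer_of_print`** proves it.  The two antecedents are REFEREED print facts used as named
hypotheses (Beauville 1983 Thm 4 / Prop 8: `Kⁿ(A)` is irreducible symplectic, here only for `b₁(Kⁿ(A)) = 0`; Beauville
§7 footnote 2 / Kapfer–Menet Lemma 5.4: `Θ : A × Kⁿ(A) → A^[n+1]` is the Galois quotient by `A[n+1]`); everything else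
is kernel: the Künneth isomorphism (`HodgeTheory/TotalCohomologyKunneth`), the transfer of the finite Galois cover
(`…TransferCover`: `Θ^*` injective, `im Θ^* = κ(H*(A) ⊗ im θ^*)`), the splitting `Θ^* ℓ = fst^* x + snd^* θ^* ℓ`
(`…TransferFibre`), hard Lefschetz of `x` on the abelian surface (a tensor FACTOR of a Lefschetz module is Lefschetz,
`Algebra/Lie/LefschetzModuleTensorFactor`) and the naturality of the `𝔰𝔩₂`-partner (`Algebra/Lie/Sl2Intertwiner`)
giving `Θ^* ∘ Λ_H = κ(Λ_A ⊗ 1 + 1 ⊗ Λ_K)κ⁻¹ ∘ Θ^*` (`…TransferLefschetz`), and the two directions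
(`…TransferDirections`).  At `n = 0` the statement is vacuous (`K` is a point, `h_K = 0`, no dual Lefschetz operator).

HONEST FRAMING: this closes V0 CONDITIONALLY on the two named print facts, exactly as the item is typed; nothing here
asserts L1, `HC_Kum4Type` or any case of the Hodge conjecture.
-/

noncomputable section

open CategoryTheory MonoidalCategory CartesianMonoidalCategory DirectSum TensorProduct
open Literature.AlgebraicTopology.SingularHomology
open Literature.AlgebraicGeometry Literature.AlgebraicGeometry.Motives Literature.AlgebraicGeometry.Hyperkaehler
open Literature.AlgebraicGeometry.HilbertScheme Literature.AlgebraicGeometry.HodgeTheory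

namespace Summit.Ventures.HodgeKum4.HilbertKummer

open scoped MonObj

/-- **V0 (the Hilbert ⟷ Kummer transfer) from its two print antecedents.**  For every abelian surface `A`, every
Hilbert scheme `(H, Ξ)` of `n + 1` points of `A` (smooth projective of dimension `2(n+1)`), every Kummer fibre
`j : K ⟶ H` (smooth projective of dimension `2n`), every `ℓ ∈ H²(H(ℂ))` with dual Lefschetz operator `Λ_H` and every
dual Lefschetz operator `Λ_K` of `θ^* ℓ`:
`⟨H^{≤3}(H)⟩_{(Λ_H, ∪)} = H*(H) ↔ im θ^* ⊆ ⟨θ^* H^{≤3}(H)⟩_{(Λ_K, ∪)}`. -/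
theorem hilbertKummerTransfer_of_print' (hBe : Beauville1983_irreducibleSymplectic_of_kummerType)
    (hG : Beauville1983_kummerCover_galois) : Summit.Ventures.HodgeKum4.HilbertKummerTransfer := by
  intro n A K H hA Ξ 𝒜 x₀ j hHilb hHs hsq hKs ℓ Λ_H Λ_K hΛH hΛK
  -- `n = 0` is vacuous: `K` is a point, `h_K = 0`
  obtain rfl | hn := Nat.eq_zero_or_pos n
  · exact (not_isDualLefschetz_of_dim_zero hKs _ _ hΛK).elim
  have hn : 1 ≤ n := hn
  -- the abelian surface, the translation action, the Galois datum
  have hS : IsSmoothProjective 2 A.X := hA ▸ AbelianVariety.isSmoothProjective_holds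
  have hact : IsTranslationAction Ξ (translationAction hHilb) := isTranslationAction_translationAction hHilb
  obtain ⟨G, _, _, _, c, hc, -, hdeck3, -⟩ := hG hA Ξ 𝒜 x₀ j (translationAction hHilb) hHilb hHs hsq hKs hact
  have hdeck : ∀ g : G, ∃ (b : 𝟙_ (SchemeOver ℂ) ⟶ A.X) (τ : K ⟶ K),
      c.deck g = AlgPoints.mapContinuous (L := ℂ) (A.translate b⁻¹ ⊗ₘ τ) := fun g ↦ by
    obtain ⟨b, τ, -, -, h⟩ := hdeck3 g
    exact ⟨b, τ, h⟩
  -- `b₁(K) = 0` (Beauville: `Kⁿ(A)` is irreducible symplectic, hence simply connected)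
  have h1 : ∀ w : complexBetti K 1, w = 0 := by
    have hKum : IsGeneralizedKummerVarietyOf n A K := ⟨H, Ξ, 𝒜, x₀, j, hHilb, hHs, hsq⟩
    have hI := Beauville1983_irreducibleSymplectic_of_kummerType.generalizedKummer hBe hn hA hKum hKs
    haveI : SimplyConnectedSpace (ComplexPoints K) := hI.2.1
    haveI := ModuleCat.subsingleton_of_isZero
      (isZero_singularCohomology_one_of_simplyConnectedSpace (X := ComplexPoints K) ℂ)
    exact fun w ↦ Subsingleton.elim w 0
  -- `Θ^* ℓ = fst^* x + snd^* θ^* ℓ`, `Λ_A`, `Λ_P`, `Θ^* ∘ Λ_H = Λ_P ∘ Θ^*`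
  obtain ⟨x, hx⟩ := exists_map_kummerCover_two_eq hS hKs hHilb hact h1 ℓ
  obtain ⟨Λ_A, hΛA, -, hcomm⟩ :=
    exists_isDualLefschetz_comp_eq c hc hdeck hS hKs hHilb hact hHs hn ℓ hx hΛH hΛK
  -- the two directions
  constructor
  · intro hgen
    exact range_le_opCupSpan_of_eq_top c hc hdeck hS hKs hHilb hact ℓ hΛK hcomm hgen
  · intro hrange
    exact opCupSpan_eq_top_of_range_le c hc hdeck hS hKs hHilb hact hΛA hcomm hrange

end Summit.Ventures.HodgeKum4.HilbertKummer

namespace Summit.Ventures.HodgeKum4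

/-- **V0 — the route item `HilbertKummerTransfer` (stmt-Ventures-20354) in its typed antecedent form:
`Beauville1983_irreducibleSymplectic_of_kummerType → Beauville1983_kummerCover_galois → HilbertKummerTransfer`.**
Closes the crux (rank 3) of lane (V) of route `KummerFixedLocus` modulo its two REFEREED print inputs, by name. -/
theorem hilbertKummerTransfer_of_print : Summit.Ventures.HodgeKum4.Theses.KummerFixedLocus.HilbertKummerTransfer :=
  fun hBe hG ↦ HilbertKummer.hilbertKummerTransfer_of_print' hBe hG

end Summit.Ventures.HodgeKum4

end
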